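import Summits.HodgeConjecture.CorCM.OcticCurveFourfoldPowersHodgeOfMarkman
import Summits.HodgeConjecture.CorCM.NonGaloisSexticCMFrame
import HarnessLib

/-!
# COR-CM — the Hodge conjecture for every product of copies of a CM abelian FOURFOLD `B` with CM by an OCTIC CM field
# containing an imaginary quadratic field `k`, `k`-signature `(1,3)`, and the CM elliptic curve `E` of `k`, GIVEN ONLY
# Markman's hyperbolic-sixfold theorem: the INTRINSIC form (no frame in the statement)

Cell `pub-hodgecm2` (COR-CM), seat b30 gen 18 (2026-08-21); count-neutral own lane OCTIC-EB = lit-andre-3's prover-lane ask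
A6-R26, GENERALISED.  Theorems only, no definition, no named fact, no `sorry`.  HONEST FRAMING: CONDITIONAL on the single
displayed named fact `HodgeTheory.Markman2025_weilClasses_algebraic_hyperbolicSixfold` (E. Markman, arXiv:2502.03415 Thm 1.5.1,
UNREFEREED); `HC_CM` is not asserted; nothing here is a case of the Hodge conjecture proved unconditionally.

* `exists_frame` — THE FRAME EXISTS, for every CM field `K` of degree `8`, every `i : k → K` from a quadratic `k` with
  `Hom(k,ℂ) = {τ, τ̄}`, and every CM type `Φ` of `K` with exactly ONE member over `τ`: an enumeration
  `e : Hom(K, ℂ) ≃ Fin 4 × Bool` by (conjugate pair, sign) with `Φ = e⁻¹{(0,true),(1,false),(2,false),(3,false)}` — pure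
  counting (`card_filter_comp_eq_four`), no Galois theory;
* `exists_delta_of_mem` — for `δ² = -d` in `k` and `τ ∈ Ψ` there is `δ' = ±δ` with `τ(δ') = i√d`;
* **`hodgeConjectureFor_biproduct_comp_vec_of_markmanSixfold`** — THE THEOREM.  Data: `K` a CM field with `[K:ℚ] = 8`
  (NO Galois hypothesis: e.g. `k·F₀` for any totally real quartic `F₀`, as well as the (ℤ/2)³ and ℤ/4×ℤ/2 fields of A6-R26),
  `k` with `[k:ℚ] = 2` and `i : k →+* K`, `δ ∈ 𝓞_k` with `δ² = -d < 0`; realisations on `H¹` (`IsCMTypeRealisation`)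
  `B ⊨ (K; Φ)` (a CM abelian fourfold, simple or not) and `E ⊨ (k; Ψ)` (a CM elliptic curve) with `τ ∈ Ψ` and
  `#{s ∈ Φ | s ∘ i = τ} = 1` — `k`-SIGNATURE `(1,3)`.  Conclusion: for every slot map `κ : Fin N → Fin 2`, every rational
  `(q,q)`-class on `⨁_j ![B, E] (κ j)` — i.e. on `B^n × E^a`, all `n, a`, any order, e.g. the Weil sixfold `B × E × E` — is
  algebraic.  (`k`-signature `(3,1)` is the same statement for the conjugate structure on `E`, i.e. for `τ̄ ∈ Ψ̄`.)
* corollaries: `…_of_avDominatedBy_…` (everything dominated: isogeny factors, abelian subvarieties, quotients of such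
  products), `hodgeConjectureFor_prod_prod_of_markmanSixfold` (the sixfold `(B × E) × E` itself), and §3
  `…_of_card_eq_three` — the `k`-signature `(3,1)` form (`#{s ∈ Φ | s ∘ i = τ} = 3`), by the conjugate structure on `E`.
WHAT IS NEW (numbers, not adjectives).  Lit-andre-3 `Census/OcticTriquadraticWeilColumn` / `…C4C2NonsquareWeilColumn`
(2026-08-21) certify for the two Galois octic types with imaginary quadratic subfields that the Hodge lattice of the
one-curve sub-slice `{E^a × B^n}` is `5` pairs `⊕ ℤ·(Weil class of B × E²)`; seat b25's `CurveTimesMultiquadraticCMSquare`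
shows `E² × Y` FAILS product span (the Weil class).  This file closes `HC(E^a × B^n)` modulo Markman for EVERY octic CM
field `⊇ k`, the first members of these slices beyond dimension `5`.
[cite: Markman2025SecantWeil, Thm 1.5.1] [cite: Pohlmann1968, Thm 1] [cite: Deligne1982HodgeCycles, §4 Prop. 4.4, §5 (c)]
[cite: MoonenZarhin1999LowDim, Thm. 0.1 (a)] [cite: vanGeemen1994HodgeAV, 4.9 and (5.4.1)]

## References
* [Markman2025SecantWeil] E. Markman, arXiv:2502.03415 (unrefereed), Thm 1.5.1.  [Pohlmann1968] H. Pohlmann, Ann. of Math.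
  88 (1968), Thm 1.  [Deligne1982HodgeCycles] P. Deligne, LNM 900 (1982), §4 Prop. 4.4, §5 (c).  [MoonenZarhin1999LowDim]
  B. Moonen, Yu. Zarhin, Math. Ann. 315 (1999), Thm. 0.1 (a).  [vanGeemen1994HodgeAV] B. van Geemen, LNM 1594 (1994), 3.7,
  4.9, (5.4.1).  [Shimura1998] G. Shimura, *Abelian varieties with complex multiplication*, §18.2 Lemma.
-/

noncomputable section

open CategoryTheory CategoryTheory.Limits NumberField

namespace Summit.HodgeConjecture.CorCM.OcticCurveFourfold

open Literature.AlgebraicGeometry Literature.AlgebraicGeometry.Motives Literature.AlgebraicGeometry.HodgeTheory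
open Literature.AlgebraicGeometry.ComplexMultiplication (IsCMTypeRealisation)
open Literature.AlgebraicTopology.SingularHomology
open Summit.HodgeConjecture.CorCM.Census.OcticCurveFourfold (Pt phi phiPre inr_mem_phiPre)
open Summit.HodgeConjecture.CorCM.DecicCurveFivefold (curveSlots₂)
open Summit.HodgeConjecture.CorCM.WeilFourfold (exists_apply_eq_I_mul_sqrt)
open Summit.HodgeConjecture.CorCM.NonGaloisField (conjugate_comp)

open scoped Classical

/-! ## §1 The frame exists (pure counting) -/

section Frame

variable {K : Type} [Field K] [NumberField K] {k : Type} [Field k] [NumberField k]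

/-- **THE FRAME EXISTS.**  For `[K:ℚ] = 8`, `i : k → K`, `Hom(k, ℂ) = {τ, τ̄}` and a CM type `Φ` of `K` with exactly one
member `sP` over `τ`, there is an enumeration `e : Hom(K, ℂ) ≃ Fin 4 × Bool` with `(e s).2 = [s ∘ i = τ]`,
`e s̄ = ((e s).1, ¬(e s).2)` and `Φ = e⁻¹ phi` (`phi = {(0,true)} ⊔ {(a,false) | a ≠ 0}`): number the four embeddings over
`τ` with `sP` first and give `s̄` the number of `s`.  [cite: Shimura1998, §18.2 Lemma] -/
theorem exists_frame (h8 : Module.finrank ℚ K = 8) (h2 : Module.finrank ℚ k = 2) (i : k →+* K) {τ : k →+* ℂ}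
    (hττ : ComplexEmbedding.conjugate τ ≠ τ) (hk : ∀ σ : k →+* ℂ, σ = τ ∨ σ = ComplexEmbedding.conjugate τ)
    (Φ : CMType K) (h1 : (Finset.univ.filter fun s : K →+* ℂ => s.comp i = τ ∧ s ∈ Φ.1).card = 1) :
    ∃ e : (K →+* ℂ) ≃ Fin 4 × Bool, (∀ s, (e s).2 = true ↔ s.comp i = τ) ∧
      (∀ s, e (ComplexEmbedding.conjugate s) = ((e s).1, !(e s).2)) ∧ ∀ s, s ∈ Φ.1 ↔ Sum.inr (e s) ∈ phi := by
  -- the member `sP` of `Φ` over `τ`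
  obtain ⟨sP, hsP⟩ := Finset.card_eq_one.1 h1
  have hsPmem : sP.comp i = τ ∧ sP ∈ Φ.1 := by
    have h : sP ∈ Finset.univ.filter fun s : K →+* ℂ => s.comp i = τ ∧ s ∈ Φ.1 := by rw [hsP]; simp
    exact (Finset.mem_filter.1 h).2
  have huniq : ∀ s : K →+* ℂ, s.comp i = τ → (s ∈ Φ.1 ↔ s = sP) := by
    intro s hs
    constructor
    · intro hΦ
      have h : s ∈ Finset.univ.filter fun s : K →+* ℂ => s.comp i = τ ∧ s ∈ Φ.1 := Finset.mem_filter.2 ⟨by simp, hs, hΦ⟩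
      rw [hsP] at h
      exact Finset.mem_singleton.1 h
    · rintro rfl; exact hsPmem.2
  -- the four embeddings over `τ`, numbered with `sP ↦ 0`
  set F : Finset (K →+* ℂ) := Finset.univ.filter fun s : K →+* ℂ => s.comp i = τ with hFdef
  have hF : F.card = 4 := card_filter_comp_eq_four i h8 h2 τ
  let f : {s // s ∈ F} ≃ Fin 4 := F.equivFinOfCardEq hF
  have hsPF : sP ∈ F := Finset.mem_filter.2 ⟨Finset.mem_univ _, hsPmem.1⟩
  let g : {s // s ∈ F} ≃ Fin 4 := f.trans (Equiv.swap (f ⟨sP, hsPF⟩) 0)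
  have hgP : g ⟨sP, hsPF⟩ = 0 := by simp [g]
  have hmemF : ∀ s : K →+* ℂ, s ∈ F ↔ s.comp i = τ := fun s => by simp [hFdef]
  -- over `τ̄` the conjugate lies over `τ`
  have hconj_over : ∀ s : K →+* ℂ, ¬ s.comp i = τ → (ComplexEmbedding.conjugate s).comp i = τ := by
    intro s hs
    rw [conjugate_comp, (hk (s.comp i)).resolve_left hs, ComplexEmbedding.involutive_conjugate]
  have hconj_over' : ∀ s : K →+* ℂ, s.comp i = τ → ¬ (ComplexEmbedding.conjugate s).comp i = τ := by
    intro s hs h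
    rw [conjugate_comp, hs] at h
    exact hττ h
  -- the enumeration
  let toF : (K →+* ℂ) → Fin 4 × Bool := fun s =>
    if h : s.comp i = τ then (g ⟨s, (hmemF s).2 h⟩, true)
    else (g ⟨ComplexEmbedding.conjugate s, (hmemF _).2 (hconj_over s h)⟩, false)
  let ofF : Fin 4 × Bool → (K →+* ℂ) := fun p =>
    if p.2 then (g.symm p.1).1 else ComplexEmbedding.conjugate (g.symm p.1).1
  have hgF : ∀ a : Fin 4, ((g.symm a).1).comp i = τ := fun a => (hmemF _).1 (g.symm a).2
  have hcc : ∀ s : K →+* ℂ, ComplexEmbedding.conjugate (ComplexEmbedding.conjugate s) = s :=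
    ComplexEmbedding.involutive_conjugate K
  have hgcongr : ∀ (s t : K →+* ℂ) (hs : s ∈ F) (ht : t ∈ F), s = t → g ⟨s, hs⟩ = g ⟨t, ht⟩ := by
    rintro s t hs ht rfl; rfl
  have htoF_pos : ∀ s (h : s.comp i = τ), toF s = (g ⟨s, (hmemF s).2 h⟩, true) := fun s h => dif_pos h
  have htoF_neg : ∀ s (h : ¬ s.comp i = τ),
      toF s = (g ⟨ComplexEmbedding.conjugate s, (hmemF _).2 (hconj_over s h)⟩, false) := fun s h => dif_neg h
  have htoF_of : ∀ p, toF (ofF p) = p := by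
    rintro ⟨a, b⟩
    cases b
    · have hof : ofF (a, false) = ComplexEmbedding.conjugate (g.symm a).1 := rfl
      have h : ¬ (ComplexEmbedding.conjugate (g.symm a).1).comp i = τ := hconj_over' _ (hgF a)
      rw [hof, htoF_neg _ h, Prod.mk.injEq]
      refine ⟨?_, rfl⟩
      rw [hgcongr _ _ _ (g.symm a).2 (hcc _), Subtype.coe_eta, Equiv.apply_symm_apply]
    · have hof : ofF (a, true) = (g.symm a).1 := rfl
      rw [hof, htoF_pos _ (hgF a), Prod.mk.injEq]
      exact ⟨by rw [Subtype.coe_eta, Equiv.apply_symm_apply], rfl⟩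
  have hof_toF : ∀ s, ofF (toF s) = s := by
    intro s
    by_cases h : s.comp i = τ
    · rw [htoF_pos s h]
      change (g.symm (g ⟨s, _⟩)).1 = s
      rw [Equiv.symm_apply_apply]
    · rw [htoF_neg s h]
      change ComplexEmbedding.conjugate (g.symm (g ⟨ComplexEmbedding.conjugate s, _⟩)).1 = s
      rw [Equiv.symm_apply_apply]
      exact hcc s
  let e : (K →+* ℂ) ≃ Fin 4 × Bool := ⟨toF, ofF, hof_toF, htoF_of⟩
  have he : ∀ s, e s = toF s := fun _ => rfl
  refine ⟨e, fun s => ?_, fun s => ?_, fun s => ?_⟩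
  · -- signs
    rw [he]
    by_cases h : s.comp i = τ
    · rw [htoF_pos s h]; exact ⟨fun _ => h, fun _ => rfl⟩
    · rw [htoF_neg s h]; exact ⟨fun h' => absurd h' Bool.false_ne_true, fun h' => absurd h' h⟩
  · -- conjugation
    rw [he, he]
    by_cases h : s.comp i = τ
    · have h' : ¬ (ComplexEmbedding.conjugate s).comp i = τ := hconj_over' s h
      rw [htoF_pos s h, htoF_neg _ h', Prod.mk.injEq]
      exact ⟨hgcongr _ _ _ _ (hcc s), rfl⟩
    · have h' : (ComplexEmbedding.conjugate s).comp i = τ := hconj_over s h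
      rw [htoF_neg s h, htoF_pos _ h']
      rfl
  · -- the type
    rw [he, phi, inr_mem_phiPre]
    by_cases h : s.comp i = τ
    · rw [htoF_pos s h, huniq s h]
      constructor
      · rintro rfl
        left
        exact Prod.ext hgP rfl
      · rintro (hp | ⟨hb, -⟩)
        · have h0 : g ⟨s, (hmemF s).2 h⟩ = g ⟨sP, hsPF⟩ := by rw [hgP]; exact (Prod.ext_iff.1 hp).1
          exact congrArg Subtype.val (g.injective h0)
        · exact absurd rfl hb
    · have hc : (ComplexEmbedding.conjugate s).comp i = τ := hconj_over s h
      rw [htoF_neg s h, Φ.2 s, huniq _ hc]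
      constructor
      · intro hne
        right
        refine ⟨Bool.false_ne_true, fun h0 => hne ?_⟩
        have h0' : g ⟨ComplexEmbedding.conjugate s, (hmemF _).2 hc⟩ = g ⟨sP, hsPF⟩ := by rw [hgP]; exact h0
        exact congrArg Subtype.val (g.injective h0')
      · rintro (hp | ⟨-, ha⟩)
        · exact absurd (Prod.ext_iff.1 hp).2 Bool.false_ne_true
        · intro heq
          apply ha
          have : (⟨ComplexEmbedding.conjugate s, (hmemF _).2 hc⟩ : {s // s ∈ F}) = ⟨sP, hsPF⟩ := Subtype.ext heq
          rw [this, hgP]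

/-- **Choosing the sign of `δ`**: if `δ² = -d` (`d > 0`) in the quadratic field `k` then for every `τ : k → ℂ` one of
`δ' = ±δ` has `δ'² = -d` and `τ(δ') = i√d`. [folklore] -/
theorem exists_delta_of_mem (h2 : Module.finrank ℚ k = 2) {δ : 𝓞 k} {d : ℕ} (hd : 0 < d)
    (hδ : ((δ : k)) ^ 2 = -(d : k)) (τ : k →+* ℂ) :
    ∃ δ' : 𝓞 k, ((δ' : k)) ^ 2 = -(d : k) ∧ τ (δ' : k) = Complex.I * (Real.sqrt d : ℂ) := by
  obtain ⟨τ', hτ'⟩ := exists_apply_eq_I_mul_sqrt hδ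
  rcases DihedralSexticPair.eq_or_eq_conjugate h2 hd hτ' τ with rfl | rfl
  · exact ⟨δ, hδ, hτ'⟩
  · refine ⟨-δ, ?_, ?_⟩
    · push_cast; rw [neg_sq]; exact hδ
    · push_cast
      rw [map_neg, ComplexEmbedding.conjugate_coe_eq, hτ', map_mul, Complex.conj_I, Complex.conj_ofReal, neg_mul, neg_neg]

end Frame

/-! ## §2 The intrinsic theorem -/

section Main

variable {K : Type} [Field K] [NumberField K] [IsCMField K] {k : Type} [Field k] [NumberField k] [IsCMField k]
  {N : ℕ} {Φ : CMType K} {B : AbelianVariety ℂ} {ιB : 𝓞 K →+* End B} {θB : K →+* Module.End ℂ (complexBetti B.X 1)}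
  {Ψ : CMType k} {E : AbelianVariety ℂ} {ιE : 𝓞 k →+* End E} {θE : k →+* Module.End ℂ (complexBetti E.X 1)}

/-- **THE HODGE CONJECTURE FOR EVERY PRODUCT OF COPIES OF `B` AND `E`, GIVEN ONLY Markman's hyperbolic-sixfold theorem.**
`K` ANY CM field of degree `8` (no Galois hypothesis), `k` quadratic with `i : k → K`, `δ ∈ 𝓞_k`, `δ² = -d < 0`; `B ⊨ (K; Φ)`
a CM abelian fourfold and `E ⊨ (k; Ψ)` a CM elliptic curve (realisations on `H¹`), with `τ ∈ Ψ` and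
`#{s ∈ Φ | s ∘ i = τ} = 1` (`k`-signature `(1,3)`).  Then for every `κ : Fin N → Fin 2`, every rational `(q,q)`-class on
`⨁_j ![B, E] (κ j)` (`B^n × E^a`, any order) is algebraic.  Proof: `exists_delta_of_mem`, `exists_frame`, and the frame form
`hodgeConjectureFor_biproduct_comp_of_frame_of_markmanSixfold` at `Kf = (k, K)`.  Displayed leaf:
`Markman2025_weilClasses_algebraic_hyperbolicSixfold` (UNREFEREED); nothing else. [cite: Markman2025SecantWeil, Thm 1.5.1]
[cite: Pohlmann1968, Thm 1] [cite: Deligne1982HodgeCycles, §4 Prop. 4.4, §5 (c)] [cite: MoonenZarhin1999LowDim, Thm. 0.1 (a)] -/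
theorem hodgeConjectureFor_biproduct_comp_vec_of_markmanSixfold
    (hM : Markman2025_weilClasses_algebraic_hyperbolicSixfold)
    (h8 : Module.finrank ℚ K = 8) (h2 : Module.finrank ℚ k = 2) (i : k →+* K)
    {δ : 𝓞 k} {d : ℕ} (hd : 0 < d) (hδ : ((δ : k)) ^ 2 = -(d : k))
    (hB : IsCMTypeRealisation Φ B ιB θB) (hE : IsCMTypeRealisation Ψ E ιE θE)
    {τ : k →+* ℂ} (hτΨ : τ ∈ Ψ.1)
    (h13 : (Finset.univ.filter fun s : K →+* ℂ => s.comp i = τ ∧ s ∈ Φ.1).card = 1) (κ : Fin N → Fin 2) :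
    HodgeConjectureFor (⨁ fun j => (![B, E] : Fin 2 → AbelianVariety ℂ) (κ j)).dim
      (⨁ fun j => (![B, E] : Fin 2 → AbelianVariety ℂ) (κ j)).X := by
  obtain ⟨δ', hδ', hτ⟩ := exists_delta_of_mem h2 hd hδ τ
  have hττ : ComplexEmbedding.conjugate τ ≠ τ := CMThreefoldPair.conjugate_ne_of_apply_eq hd hτ
  have hk : ∀ σ : k →+* ℂ, σ = τ ∨ σ = ComplexEmbedding.conjugate τ := fun σ =>
    DihedralSexticPair.eq_or_eq_conjugate h2 hd hτ σ
  have hΨ : ∀ σ : k →+* ℂ, σ ∈ Ψ.1 ↔ σ = τ := by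
    intro σ
    rcases hk σ with rfl | rfl
    · exact ⟨fun _ => rfl, fun _ => hτΨ⟩
    · exact ⟨fun h => absurd h ((Ψ.2 τ).1 hτΨ), fun h => absurd h hττ⟩
  obtain ⟨e, he_sign, he_conj, hΦ⟩ := exists_frame h8 h2 i hττ hk Φ h13
  -- the two-slot family `Kf = (k, K)`
  let Kf : Fin 2 → Type := Fin.cons k fun _ : Fin 1 => K
  letI instF : ∀ j, Field (Kf j) := fun j =>
    Fin.cases (motive := fun j => Field (Kf j)) ‹Field k› (fun _ => ‹Field K›) j
  letI instN : ∀ j, NumberField (Kf j) := fun j =>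
    Fin.cases (motive := fun j => NumberField (Kf j)) ‹NumberField k› (fun _ => ‹NumberField K›) j
  haveI instC : ∀ j, IsCMField (Kf j) := fun j =>
    Fin.cases (motive := fun j => IsCMField (Kf j)) ‹IsCMField k› (fun _ => ‹IsCMField K›) j
  exact hodgeConjectureFor_biproduct_comp_of_frame_of_markmanSixfold (Kf := Kf) (i₀ := 0) (i₁ := 1)
    (A₂ := ![B, E]) (Φ₂ := Fin.cons Φ (Fin.cons Ψ finZeroElim)) (ι₂ := Fin.cons ιB (Fin.cons ιE finZeroElim))
    (θ₂ := Fin.cons θB (Fin.cons θE finZeroElim)) hM κ h8 h2 i hd hδ' hτ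
    (Fin.cases hB (Fin.cases hE fun l => l.elim0)) e he_sign he_conj hΦ hΨ

/-- **The Hodge conjecture for every abelian variety dominated by a product of copies of `B` and `E`** (intrinsic form,
modulo Markman's sixfold theorem): everything isogenous to an abelian subvariety or quotient of some `B^n × E^a`.
[cite: Markman2025SecantWeil, Thm 1.5.1] [cite: MumfordAV1970, §19] -/
theorem hodgeConjectureFor_of_avDominatedBy_comp_vec_of_markmanSixfold
    (hM : Markman2025_weilClasses_algebraic_hyperbolicSixfold)
    (h8 : Module.finrank ℚ K = 8) (h2 : Module.finrank ℚ k = 2) (i : k →+* K)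
    {δ : 𝓞 k} {d : ℕ} (hd : 0 < d) (hδ : ((δ : k)) ^ 2 = -(d : k))
    (hB : IsCMTypeRealisation Φ B ιB θB) (hE : IsCMTypeRealisation Ψ E ιE θE)
    {τ : k →+* ℂ} (hτΨ : τ ∈ Ψ.1)
    (h13 : (Finset.univ.filter fun s : K →+* ℂ => s.comp i = τ ∧ s ∈ Φ.1).card = 1) (κ : Fin N → Fin 2)
    {C : AbelianVariety ℂ} (hC : Domination.AVDominatedBy C (⨁ fun j => (![B, E] : Fin 2 → AbelianVariety ℂ) (κ j))) :
    HodgeConjectureFor C.dim C.X :=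
  Domination.hodgeConjectureFor_of_avDominatedBy
    (hodgeConjectureFor_biproduct_comp_vec_of_markmanSixfold hM h8 h2 i hd hδ hB hE hτΨ h13 κ) hC

/-- **The Weil sixfold `(B × E) × E` itself** (intrinsic form, modulo Markman's sixfold theorem): the Hodge conjecture holds
for `(B × E) × E` — it is isomorphic to `⨁_j ![B, E] (κ j)` for `κ = (0, 1, 1)` along `((fst∘fst, snd∘fst, snd))`
(`HodgeConjectureFor.of_isIsogenous`). [cite: Markman2025SecantWeil, Thm 1.5.1] [cite: vanGeemen1994HodgeAV, 3.7] -/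
theorem hodgeConjectureFor_prod_prod_of_markmanSixfold
    (hM : Markman2025_weilClasses_algebraic_hyperbolicSixfold)
    (h8 : Module.finrank ℚ K = 8) (h2 : Module.finrank ℚ k = 2) (i : k →+* K)
    {δ : 𝓞 k} {d : ℕ} (hd : 0 < d) (hδ : ((δ : k)) ^ 2 = -(d : k))
    (hB : IsCMTypeRealisation Φ B ιB θB) (hE : IsCMTypeRealisation Ψ E ιE θE)
    {τ : k →+* ℂ} (hτΨ : τ ∈ Ψ.1)
    (h13 : (Finset.univ.filter fun s : K →+* ℂ => s.comp i = τ ∧ s ∈ Φ.1).card = 1) :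
    HodgeConjectureFor ((B.prod E).prod E).dim ((B.prod E).prod E).X := by
  let κ : Fin 3 → Fin 2 := ![0, 1, 1]
  let A : Fin 3 → AbelianVariety ℂ := fun j => (![B, E] : Fin 2 → AbelianVariety ℂ) (κ j)
  have h := hodgeConjectureFor_biproduct_comp_vec_of_markmanSixfold hM h8 h2 i hd hδ hB hE hτΨ h13 κ
  change HodgeConjectureFor (⨁ A).dim (⨁ A).X at h
  have hA0 : A 0 = B := rfl
  have hA1 : A 1 = E := rfl
  have hA2 : A 2 = E := rfl
  -- the comparison isomorphism `(A 0 × A 1) × A 2 ≅ ⨁ A`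
  obtain ⟨c, hc0, hc1, hc2⟩ := comparison₃_components_def (A := A)
  let g : ((A 0).prod (A 1)).prod (A 2) ⟶ ⨁ A := biproduct.lift c
  let hinv : ⨁ A ⟶ ((A 0).prod (A 1)).prod (A 2) := AbelianVariety.prodLift
    (AbelianVariety.prodLift (biproduct.π A 0) (biproduct.π A 1)) (biproduct.π A 2)
  have hgc : ∀ m, g ≫ biproduct.π A m = c m := fun m => biproduct.lift_π _ _
  have hsec : hinv ≫ g = 𝟙 (⨁ A) := by
    refine biproduct.hom_ext _ _ fun m => ?_
    rw [Category.assoc, hgc, Category.id_comp]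
    refine Fin.cases ?_ (fun m' => Fin.cases ?_ (fun m'' => Fin.cases ?_ (fun l => l.elim0) m'') m') m
    · rw [hc0, ← Category.assoc, AbelianVariety.prodLift_fst, AbelianVariety.prodLift_fst]
    · change hinv ≫ c 1 = biproduct.π A 1
      rw [hc1, ← Category.assoc, AbelianVariety.prodLift_fst, AbelianVariety.prodLift_snd]
    · change hinv ≫ c 2 = biproduct.π A 2
      rw [hc2, AbelianVariety.prodLift_snd]
  have hh1 : hinv ≫ AbelianVariety.fst ((A 0).prod (A 1)) (A 2) =
      AbelianVariety.prodLift (biproduct.π A 0) (biproduct.π A 1) := AbelianVariety.prodLift_fst _ _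
  have hh2 : hinv ≫ AbelianVariety.snd ((A 0).prod (A 1)) (A 2) = biproduct.π A 2 := AbelianVariety.prodLift_snd _ _
  have hret : g ≫ hinv = 𝟙 _ := by
    refine AbelianVariety.prod_hom_ext ?_ ?_
    · refine AbelianVariety.prod_hom_ext ?_ ?_
      · rw [Category.id_comp, Category.assoc, Category.assoc, ← Category.assoc hinv, hh1, AbelianVariety.prodLift_fst,
          hgc, hc0]
      · rw [Category.id_comp, Category.assoc, Category.assoc, ← Category.assoc hinv, hh1, AbelianVariety.prodLift_snd,
          hgc, hc1]
    · rw [Category.id_comp, Category.assoc, hh2, hgc, hc2]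
  exact HodgeConjectureFor.of_isIsogenous ⟨_, AbelianVariety.isIsogeny_hom_of_iso
    { hom := g, inv := hinv, hom_inv_id := hret, inv_hom_id := hsec }⟩ h

end Main

/-! ## §3 `k`-signature `(3,1)`: the conjugate structure on `E` -/

section ThreeOne

variable {K : Type} [Field K] [NumberField K] [IsCMField K] {k : Type} [Field k] [NumberField k] [IsCMField k]
  {N : ℕ} {Φ : CMType K} {B : AbelianVariety ℂ} {ιB : 𝓞 K →+* End B} {θB : K →+* Module.End ℂ (complexBetti B.X 1)}
  {Ψ : CMType k} {E : AbelianVariety ℂ} {ιE : 𝓞 k →+* End E} {θE : k →+* Module.End ℂ (complexBetti E.X 1)}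

omit [IsCMField K] [IsCMField k] in
/-- **From `3` over `τ` to `1` over `τ̄`**: conjugation maps the members of `Φ` over `τ̄` bijectively onto the non-members over
`τ`, so `#{s ∈ Φ | s ∘ i = τ} = 3` gives `#{s ∈ Φ | s ∘ i = τ̄} = 4 − 3 = 1`. [cite: Shimura1998, §18.2 Lemma] -/
theorem card_filter_conjugate_eq_one (h8 : Module.finrank ℚ K = 8) (h2 : Module.finrank ℚ k = 2) (i : k →+* K)
    (Φ : CMType K) (τ : k →+* ℂ) (h3 : (Finset.univ.filter fun s : K →+* ℂ => s.comp i = τ ∧ s ∈ Φ.1).card = 3) :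
    (Finset.univ.filter fun s : K →+* ℂ => s.comp i = ComplexEmbedding.conjugate τ ∧ s ∈ Φ.1).card = 1 := by
  have hcc : ∀ s : K →+* ℂ, ComplexEmbedding.conjugate (ComplexEmbedding.conjugate s) = s :=
    ComplexEmbedding.involutive_conjugate K
  have hcck : ComplexEmbedding.conjugate (ComplexEmbedding.conjugate τ) = τ := ComplexEmbedding.involutive_conjugate k τ
  -- conjugation identifies `{s ∈ Φ | s ∘ i = τ̄}` with `{s ∉ Φ | s ∘ i = τ}`
  have himg : (Finset.univ.filter fun s : K →+* ℂ => s.comp i = ComplexEmbedding.conjugate τ ∧ s ∈ Φ.1).image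
      ComplexEmbedding.conjugate = Finset.univ.filter fun s : K →+* ℂ => s.comp i = τ ∧ s ∉ Φ.1 := by
    ext s'
    simp only [Finset.mem_image, Finset.mem_filter, Finset.mem_univ, true_and]
    constructor
    · rintro ⟨s, ⟨hs, hsΦ⟩, rfl⟩
      refine ⟨by rw [conjugate_comp, hs, hcck], ?_⟩
      rwa [← Φ.2 s]
    · rintro ⟨hs', hs'Φ⟩
      refine ⟨ComplexEmbedding.conjugate s', ⟨by rw [conjugate_comp, hs'], ?_⟩, hcc s'⟩
      have h := Φ.2 (ComplexEmbedding.conjugate s')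
      rw [hcc] at h
      exact h.2 hs'Φ
  rw [← Finset.card_image_of_injective _ (ComplexEmbedding.involutive_conjugate K).injective, himg]
  have h4 := card_filter_comp_eq_four i h8 h2 τ
  have hsplit := Finset.card_filter_add_card_filter_not
    (s := Finset.univ.filter fun s : K →+* ℂ => s.comp i = τ) (fun s => s ∈ Φ.1)
  rw [Finset.filter_filter, Finset.filter_filter, h4, h3] at hsplit
  omega

/-- **`E` WITH ITS CONJUGATE STRUCTURE** realises the conjugate type `Ψ̄ = Ψ^c` (`c` = complex conjugation of `k`), and
`τ̄ ∈ Ψ̄` iff `τ ∈ Ψ` (transport of structure, `IsCMTypeRealisation.transport`). [cite: Shimura1998, §18.2 Lemma (i)] -/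
theorem conjugate_mem_cmTypeMap_complexConj {τ : k →+* ℂ} (hτΨ : τ ∈ Ψ.1) :
    ComplexEmbedding.conjugate τ ∈
      (Literature.NumberTheory.Automorphic.PicardCM.CMCode.cmTypeMap (IsCMField.complexConj k).toRingEquiv Ψ).1 := by
  rw [Literature.NumberTheory.Automorphic.PicardCM.CMCode.mem_cmTypeMap_iff]
  have h : (ComplexEmbedding.conjugate τ).comp (IsCMField.complexConj k).toRingEquiv.toRingHom = τ := by
    refine RingHom.ext fun x => ?_
    change starRingEnd ℂ (τ (IsCMField.complexConj k x)) = τ x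
    rw [IsCMField.complexEmbedding_complexConj, starRingEnd_self_apply]
  rw [h]
  exact hτΨ

/-- **`k`-signature `(3,1)`.**  The theorem `hodgeConjectureFor_biproduct_comp_vec_of_markmanSixfold` with the hypothesis
`#{s ∈ Φ | s ∘ i = τ} = 3` instead of `= 1` (`τ ∈ Ψ`): apply it to `E` with its conjugate CM structure
(`IsCMTypeRealisation.transport` along complex conjugation) and to `τ̄`, over which `Φ` has exactly one member
(`card_filter_conjugate_eq_one`); the abelian varieties — hence the conclusion — are unchanged.
[cite: Markman2025SecantWeil, Thm 1.5.1] [cite: Shimura1998, §18.2 Lemma (i)] -/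
theorem hodgeConjectureFor_biproduct_comp_vec_of_markmanSixfold_of_card_eq_three
    (hM : Markman2025_weilClasses_algebraic_hyperbolicSixfold)
    (h8 : Module.finrank ℚ K = 8) (h2 : Module.finrank ℚ k = 2) (i : k →+* K)
    {δ : 𝓞 k} {d : ℕ} (hd : 0 < d) (hδ : ((δ : k)) ^ 2 = -(d : k))
    (hB : IsCMTypeRealisation Φ B ιB θB) (hE : IsCMTypeRealisation Ψ E ιE θE)
    {τ : k →+* ℂ} (hτΨ : τ ∈ Ψ.1)
    (h31 : (Finset.univ.filter fun s : K →+* ℂ => s.comp i = τ ∧ s ∈ Φ.1).card = 3) (κ : Fin N → Fin 2) :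
    HodgeConjectureFor (⨁ fun j => (![B, E] : Fin 2 → AbelianVariety ℂ) (κ j)).dim
      (⨁ fun j => (![B, E] : Fin 2 → AbelianVariety ℂ) (κ j)).X :=
  hodgeConjectureFor_biproduct_comp_vec_of_markmanSixfold hM h8 h2 i hd hδ hB
    (hE.transport (IsCMField.complexConj k).toRingEquiv) (conjugate_mem_cmTypeMap_complexConj hτΨ)
    (card_filter_conjugate_eq_one h8 h2 i Φ τ h31) κ

end ThreeOne

end Summit.HodgeConjecture.CorCM.OcticCurveFourfold

end
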